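import Summits.BirchSwinnertonDyer.BirchSwinnertonDyer.Theorems.PrintCf2RamifiedOffTYZEvenSquareFormLevelTwo
import HarnessLib

/-!
# Crux `PrintCf2.RamifiedOffTYZOfFacts` (stmt-BirchSwinnertonDyer-20509), line `offtyz-v7`, LEAD cycle 14 (cruxlead-20509 g13):
# THE EVEN SQUARE FORM, LEVEL THREE AND ASSEMBLY — the chains `n → 2d_S → d_W → d_T` and `g·g·P(n) = P(n) + Ψ_n(g)·τ(1)` for every `g`

THEOREMS ONLY (no `def`, no named fact, no `sorry`), `--supports stmt-BirchSwinnertonDyer-20509` (C⁺ = item 23431 even sector; the `s = 1` even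
stratum of 23432).  Part of the CLOSED-FORM REDUCTION behind the EVEN Ω-IDENTITY (crux workfiles `Lines/offtyz_v7_EvenOmega.lean`,
`Lines/offtyz_v7_RegimeFreeLaw.md` §5b; definitions `…EvenOmegaDefs`): for `n = 2p₁⋯p_k ≡ 6 (mod 8)` and EVERY automorphism `g` of `ℍ′_n`, the
`τ(1)`-coefficient of `g·g·P(n) − P(n)` in g8's even square formula `SquareSilenceEven.galPt_mul_self_P_eq_add_even` (p703022), read modulo `2`,
is an explicit `𝔽₂`-form in the bits of `g` indexed on the prime tuple — block laws of `…EvenSquareFormBlocks` (regime-free), cofactor parities as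
Monsky determinants, and the recursion indices converted to sub-tuples level by level.  BSD is not proved by any of this; no class is closed here.
* §5 `blockProd_mem_recursionIndex_two_mul_blockProd_iff` (`d_W ∈ R(2d_S) ⟺ W ⊆ S ∧ d_W ≡ 7`), the middle-and-inner sum as a sum over `T ⊊ W ⊆ S`,
  `levelThree_eq_sum_blocks`;
* §6 ★ `galPt_mul_self_P_eq_add_evenSquareForm`: `g·g·P(n) = P(n) + val(Ψ_n(g))·τ(1)` with the explicit form `Ψ_n` (even blocks weighted by
  `coblockWeight`, odd blocks `≡ 5` by the chain coefficient `c₂ + c₃`) — the Galois side of the conjectured even Ω-identity, for EVERY `g`.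

References: [cite: TianYuanZhang2017, Thm. 1.1, §3.1 (p0011 L1–L13, L53–L73), Prop. 3.2 (1)(2), Thm. 3.6 (1)(2), proof of Lemma 3.21 (p0020 L27–L63)];
[cite: HeathBrown1994SelmerCongruentII, Appendix (Monsky), typescript p. 39 L10 – p. 41 L36]; [cite: Smith2016CongruentDensity, Thm. 2.2 rows 1–3];
[cite: Cox2013, §5.C Lemma 5.19, §7.D, §9.A].
-/

noncomputable section

open scoped Classical NumberField

open WeierstrassCurve WeierstrassCurve.Affine Finset Matrix Literature.NumberTheory.EllipticCurves
  Literature.NumberTheory.EllipticCurves.TianYuanZhang2017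
  Literature.NumberTheory.EllipticCurves.TianYuanZhang2017.W2
  Literature.NumberTheory.EllipticCurves.HeathBrown1994
  Literature.NumberTheory.EllipticCurves.HeathBrown1994.Families
  Literature.NumberTheory.EllipticCurves.Smith2016
  Literature.NumberTheory.EllipticCurves.MonskySelmerParity
  Literature.NumberTheory.QuadraticFields.RingClass
  Literature.NumberTheory.QuadraticFields
  Literature.LinearAlgebra.Matrix
  Summit.BirchSwinnertonDyer.Rank1Residual.P2.GenusPeriodTransferLayer
  Summit.BirchSwinnertonDyer.Rank1Residual.P2.ThetaDescent
  Summit.BirchSwinnertonDyer.PrintCf2.QForm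

set_option autoImplicit false

namespace Summit.BirchSwinnertonDyer.PrintCf2.MoverAssembly

variable {k : ℕ} (p : Fin k → ℕ) (hp : ∀ i, (p i).Prime) (hodd : ∀ i, Odd (p i)) (hinj : Function.Injective p)

variable {n : ℕ} (D : GenusPointData n)

/-! ## §5 Level three: `n → 2d_S (≡ 6) → d_W (≡ 7) → d_T (≡ 5)` -/

include hp hodd hinj in
/-- **Membership of an odd block in `R(2d_S)`, `d_S ≡ 3 (mod 4)`**: iff `W ⊆ S` and `d_W ≡ 7 (mod 8)` (a block `≡ 5` is excluded, the quotient
`2d_{S∖W}` is `≡ 2 (mod 8)` automatically). [cite: TianYuanZhang2017, §3.1 (p0011 L67–L73)] -/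
theorem blockProd_mem_recursionIndex_two_mul_blockProd_iff (S W : Finset (Fin k)) (hS : (∏ i ∈ S, p i) % 4 = 3) :
    ∏ i ∈ W, p i ∈ recursionIndex (2 * ∏ i ∈ S, p i) ↔ W ⊆ S ∧ (∏ i ∈ W, p i) % 8 = 7 := by
  have hoddW : Odd (∏ i ∈ W, p i) := by
    rw [← prod_blockPrimes p W]; exact odd_prod _ (blockPrimes_prime p hp W) (ne_two_of_odd _ (blockPrimes_odd p hodd W))
  constructor
  · intro hmem
    obtain ⟨hdiv, h567, -, -⟩ := mem_recursionIndex_iff.mp hmem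
    have hWS : W ⊆ S := (blockProd_dvd_two_mul_blockProd_iff p hp hodd hinj W S).mp (Nat.dvd_of_mem_divisors hdiv)
    rcases h567 with h5 | h6 | h7
    · exact (not_five_mem_recursionIndex_two_mul hS hmem h5).elim
    · rcases hoddW with ⟨r, hr⟩; omega
    · exact ⟨hWS, h7⟩
  · rintro ⟨hWS, h7⟩
    have hq := two_mul_blockProd_div_blockProd p hp hWS
    have h1 : (∏ i ∈ S \ W, p i) % 4 = 1 := sdiff_mod_four_one p hWS hS (by omega)
    refine mem_recursionIndex_iff.mpr ⟨Nat.mem_divisors.mpr ⟨(blockProd_dvd_two_mul_blockProd_iff p hp hodd hinj W S).mpr hWS,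
      mul_ne_zero two_ne_zero (blockProd_pos p hp S).ne'⟩, Or.inr (Or.inr h7), ?_, ?_⟩
    · rw [hq]; omega
    · rw [hq]; have := blockProd_pos p hp (S \ W); omega

include hp hodd hinj in
/-- **The middle-and-inner sum under an even block `2d_S ∈ R(n)`** as a sum over pairs `T ⊊ W ⊆ S` (`d_W ≡ 7`, `d_T ≡ 5`); the even members
`2d_W` of `R(2d_S)` carry no block `≡ 5`. [cite: TianYuanZhang2017, §3.1 (p0011 L67–L73)] -/
theorem sum_recursionIndex_two_mul_blockProd (hn : n = 2 * ∏ i, p i) (S : Finset (Fin k)) (hS : (∏ i ∈ S, p i) % 4 = 3)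
    {M : Type*} [AddCommMonoid M] (f : ℕ → ℕ → M) :
    ∑ d' ∈ recursionIndex (2 * ∏ i ∈ S, p i), ∑ e ∈ (recursionIndex d').filter (fun e => e % 8 = 5), f d' e =
      ∑ W : Finset (Fin k), if W ⊆ S ∧ (∏ i ∈ W, p i) % 8 = 7 then
        ∑ T : Finset (Fin k), if T ⊆ W ∧ T ≠ W ∧ (∏ i ∈ T, p i) % 8 = 5 then f (∏ i ∈ W, p i) (∏ i ∈ T, p i) else 0 else 0 := by
  have hn0 : n ≠ 0 := by rw [hn]; exact mul_ne_zero two_ne_zero (Finset.prod_ne_zero_iff.mpr fun i _ => (hp i).ne_zero)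
  have hSn : (2 * ∏ i ∈ S, p i) ∣ n := by rw [hn]; exact mul_dvd_mul_left 2 (Finset.prod_dvd_prod_of_subset _ _ _ (subset_univ S))
  have hsub : recursionIndex (2 * ∏ i ∈ S, p i) ⊆ n.divisors := fun d hd =>
    Nat.mem_divisors.mpr ⟨(Nat.dvd_of_mem_divisors (Finset.mem_filter.mp hd).1).trans hSn, hn0⟩
  rw [show (∑ d' ∈ recursionIndex (2 * ∏ i ∈ S, p i), ∑ e ∈ (recursionIndex d').filter (fun e => e % 8 = 5), f d' e) =
      ∑ d' ∈ n.divisors ∩ recursionIndex (2 * ∏ i ∈ S, p i), ∑ e ∈ (recursionIndex d').filter (fun e => e % 8 = 5), f d' e by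
        rw [Finset.inter_eq_right.mpr hsub], ← Finset.sum_ite_mem, sum_divisors_two_mul p hp hodd hinj hn]
  -- even members `2d_W`: no block `≡ 5` below
  have heven0 : (∑ W : Finset (Fin k), if 2 * ∏ i ∈ W, p i ∈ recursionIndex (2 * ∏ i ∈ S, p i) then
      ∑ e ∈ (recursionIndex (2 * ∏ i ∈ W, p i)).filter (fun e => e % 8 = 5), f (2 * ∏ i ∈ W, p i) e else 0) = 0 := by
    refine Finset.sum_eq_zero fun W _ => ?_
    by_cases hmem : 2 * ∏ i ∈ W, p i ∈ recursionIndex (2 * ∏ i ∈ S, p i)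
    · rw [if_pos hmem]
      obtain ⟨-, h567, -, -⟩ := mem_recursionIndex_iff.mp hmem
      have hW4 : (∏ i ∈ W, p i) % 4 = 3 := by omega
      refine Finset.sum_eq_zero fun e he => ?_
      obtain ⟨her, he5⟩ := Finset.mem_filter.mp he
      exact (not_five_mem_recursionIndex_two_mul hW4 her he5).elim
    · rw [if_neg hmem]
  rw [heven0, add_zero]
  refine Finset.sum_congr rfl fun W _ => ?_
  by_cases hmem : ∏ i ∈ W, p i ∈ recursionIndex (2 * ∏ i ∈ S, p i)
  · have hc := (blockProd_mem_recursionIndex_two_mul_blockProd_iff p hp hodd hinj S W hS).mp hmem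
    rw [if_pos hmem, if_pos hc, sum_recursionIndex_blockProd_five p hp hodd hinj hn W hc.2]
  · have hc : ¬ (W ⊆ S ∧ (∏ i ∈ W, p i) % 8 = 7) := fun h =>
      hmem ((blockProd_mem_recursionIndex_two_mul_blockProd_iff p hp hodd hinj S W hS).mpr h)
    rw [if_neg hmem, if_neg hc]

include hp hodd hinj in
/-- **Level 3 as a form.**  `Σ_{d∈R(n) even} Σ_{d′∈R(d)} Σ_{e∈R(d′), e≡5} |𝓛(n/d)||𝓛(d/d′)||𝓛(d′/e)|·ι(e) ≡
Σ_{T : d_T ≡ 5} (Σ_{S ≠ univ, d_{Sᶜ} ≡ 1} Σ_{T ⊊ W ⊆ S, d_W ≡ 7} coblockWeight p S·det M_even(S∖W)·det M_odd(W∖T))·(1 + x_im + Σ_t x_{q_t})·(ρ^T·x_T)`.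
[cite: TianYuanZhang2017, Thm. 1.1, §3.1 (p0011 L67–L73), Thm. 3.6 (1)(2), proof of Lemma 3.21] [cite: HeathBrown1994SelmerCongruentII, Appendix (Monsky)] -/
theorem levelThree_eq_sum_blocks (hn : n = 2 * ∏ i, p i) (h3 : (∏ i, p i) % 4 = 3) (hLs : D.scriptLSpec) (h11 : thm11_parity_of_scriptL)
    {zf : ℕ → APoint D.H} {Φf : ℕ → Finset (D.H ≃ₐ[ℚ] D.H)} {ΓHf ΓH'f : ℕ → Subgroup (D.H ≃ₐ[ℚ] D.H)}
    {σf θf : ℕ → (D.H ≃ₐ[ℚ] D.H)} {cf : D.H ≃ₐ[ℚ] D.H}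
    {ρ₂ : (d : ℕ) → (D.galK d →* RingClassGroup (GenusField d) 2)}
    {ρ₄ : (d : ℕ) → (D.galK d →* RingClassGroup (GenusField d) 4)}
    (hb : ∀ d ∈ n.divisors,
      ((d % 8 = 5 ∨ d % 8 = 6) → D.CMBlockSpec d (zf d) (Φf d) (ΓHf d) (ΓH'f d) (σf d) cf) ∧
      (d % 8 = 6 → D.ThetaBlockSpec d (zf d) (ΓHf d) (ΓH'f d) (σf d) (θf d)) ∧
      (d % 8 = 7 → D.SevenBlockSpec d) ∧
      (d % 8 = 5 → D.RingClassTwoBlockSpec d (ΓHf d) (ΓH'f d) (ρ₂ d)) ∧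
      (d % 8 = 6 → D.RingClassFourBlockSpec d (ΓHf d) (ΓH'f d) (ρ₄ d)) ∧
      (d % 8 = 5 → D.FrobeniusTwoBlockSpec d (ΓH'f d)) ∧
      (d % 8 = 6 → D.FrobeniusFourBlockSpec d (ΓH'f d)) ∧
      (d % 8 = 6 → D.FrobeniusFourValueBlockSpec d (ΓH'f d) (ρ₄ d)))
    (g : D.H ≃ₐ[ℚ] D.H) :
    ((∑ d ∈ (recursionIndex n).filter (fun d => d % 2 = 0), ∑ d' ∈ recursionIndex d,
        ∑ e ∈ (recursionIndex d').filter (fun e => e % 8 = 5),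
          (D.scriptL (n / d)).natAbs * (D.scriptL (d / d')).natAbs * (D.scriptL (d' / e)).natAbs *
            (if (e % 8 = 5 ∨ e % 8 = 6) ∧ g (D.sqrtNeg e) = D.sqrtNeg e ∧ (g * g) ^ gK e * (σf e)⁻¹ ∈ ΓH'f e then 1 else 0) : ℕ) :
        ZMod 2) =
      ∑ T : Finset (Fin k), if (∏ i ∈ T, p i) % 8 = 5 then
        (∑ S : Finset (Fin k), ∑ W : Finset (Fin k),
            if T ⊆ W ∧ T ≠ W ∧ W ⊆ S ∧ (∏ i ∈ Sᶜ, p i) % 8 = 1 ∧ S ≠ univ ∧ (∏ i ∈ W, p i) % 8 = 7 then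
              coblockWeight p S * (monskyMatrixEven (blockPrimes p (S \ W))).det * (monskyMatrixOdd (blockPrimes p (W \ T))).det
            else 0) *
          ((1 + (if g D.im = D.im then (0 : ZMod 2) else 1) +
              ∑ t : Fin T.card, (if g (D.im * D.sqrtNeg (blockPrimes p T t)) = D.im * D.sqrtNeg (blockPrimes p T t) then (0 : ZMod 2) else 1)) *
            ∑ i ∈ T, blockRho p T i * (if g (D.im * D.sqrtNeg (p i)) = D.im * D.sqrtNeg (p i) then (0 : ZMod 2) else 1))
      else 0 := by
  subst hn
  set ι : ℕ → ℕ := fun d =>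
    if (d % 8 = 5 ∨ d % 8 = 6) ∧ g (D.sqrtNeg d) = D.sqrtNeg d ∧ (g * g) ^ gK d * (σf d)⁻¹ ∈ ΓH'f d then 1 else 0 with hι
  set FP : Finset (Fin k) → ZMod 2 := fun T =>
    (1 + (if g D.im = D.im then (0 : ZMod 2) else 1) +
        ∑ t : Fin T.card, (if g (D.im * D.sqrtNeg (blockPrimes p T t)) = D.im * D.sqrtNeg (blockPrimes p T t) then (0 : ZMod 2) else 1)) *
      ∑ i ∈ T, blockRho p T i * (if g (D.im * D.sqrtNeg (p i)) = D.im * D.sqrtNeg (p i) then (0 : ZMod 2) else 1) with hFP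
  have hιT : ∀ T : Finset (Fin k), (∏ i ∈ T, p i) % 8 = 5 → ((ι (∏ i ∈ T, p i) : ℕ) : ZMod 2) = FP T := fun T hT =>
    iota_five_eq_form p hp hodd hinj D rfl T hT hb g
  set L : ℕ → ℕ := fun x => (D.scriptL x).natAbs with hL
  -- Step 1 (in ℕ): the chains are `2d_S → d_W → d_T`
  have key : (∑ d ∈ (recursionIndex (2 * ∏ i, p i)).filter (fun d => d % 2 = 0), ∑ d' ∈ recursionIndex d,
      ∑ e ∈ (recursionIndex d').filter (fun e => e % 8 = 5), L ((2 * ∏ i, p i) / d) * L (d / d') * L (d' / e) * ι e) =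
      ∑ S : Finset (Fin k), if (∏ i ∈ Sᶜ, p i) % 8 = 1 ∧ S ≠ univ then
        ∑ W : Finset (Fin k), if W ⊆ S ∧ (∏ i ∈ W, p i) % 8 = 7 then
          ∑ T : Finset (Fin k), if T ⊆ W ∧ T ≠ W ∧ (∏ i ∈ T, p i) % 8 = 5 then
            L (∏ i ∈ Sᶜ, p i) * L (2 * ∏ i ∈ S \ W, p i) * L (∏ i ∈ W \ T, p i) * ι (∏ i ∈ T, p i) else 0 else 0 else 0 := by
    have hsub : (recursionIndex (2 * ∏ i, p i)).filter (fun d => d % 2 = 0) ⊆ (2 * ∏ i, p i).divisors := fun d hd =>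
      (Finset.mem_filter.mp (Finset.mem_filter.mp hd).1).1
    rw [show (∑ d ∈ (recursionIndex (2 * ∏ i, p i)).filter (fun d => d % 2 = 0), ∑ d' ∈ recursionIndex d,
        ∑ e ∈ (recursionIndex d').filter (fun e => e % 8 = 5), L ((2 * ∏ i, p i) / d) * L (d / d') * L (d' / e) * ι e) =
        ∑ d ∈ (2 * ∏ i, p i).divisors ∩ (recursionIndex (2 * ∏ i, p i)).filter (fun d => d % 2 = 0), ∑ d' ∈ recursionIndex d,
          ∑ e ∈ (recursionIndex d').filter (fun e => e % 8 = 5), L ((2 * ∏ i, p i) / d) * L (d / d') * L (d' / e) * ι e by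
          rw [Finset.inter_eq_right.mpr hsub], ← Finset.sum_ite_mem, sum_divisors_two_mul p hp hodd hinj rfl]
    -- odd `d` are filtered out
    have hodd0 : (∑ S : Finset (Fin k), if ∏ i ∈ S, p i ∈ (recursionIndex (2 * ∏ i, p i)).filter (fun d => d % 2 = 0) then
        ∑ d' ∈ recursionIndex (∏ i ∈ S, p i), ∑ e ∈ (recursionIndex d').filter (fun e => e % 8 = 5),
          L ((2 * ∏ i, p i) / ∏ i ∈ S, p i) * L ((∏ i ∈ S, p i) / d') * L (d' / e) * ι e else 0) = 0 := by
      refine Finset.sum_eq_zero fun S _ => ?_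
      rw [if_neg]
      intro h
      have h2 := (Finset.mem_filter.mp h).2
      have hoddS : Odd (∏ i ∈ S, p i) := by
        rw [← prod_blockPrimes p S]; exact odd_prod _ (blockPrimes_prime p hp S) (ne_two_of_odd _ (blockPrimes_odd p hodd S))
      rcases hoddS with ⟨r, hr⟩; omega
    rw [hodd0, zero_add]
    refine Finset.sum_congr rfl fun S _ => ?_
    by_cases hmem : 2 * ∏ i ∈ S, p i ∈ recursionIndex (2 * ∏ i, p i)
    · have hc := (two_mul_blockProd_mem_recursionIndex_iff p hp hodd rfl h3 S).mp hmem
      have hS4 := blockProd_mod_four_of_compl_one p h3 S hc.1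
      rw [if_pos (Finset.mem_filter.mpr ⟨hmem, by omega⟩), if_pos hc, div_twice_blockProd p hp rfl S,
        sum_recursionIndex_two_mul_blockProd p hp hodd hinj rfl S hS4]
      refine Finset.sum_congr rfl fun W _ => ?_
      by_cases hW : W ⊆ S ∧ (∏ i ∈ W, p i) % 8 = 7
      · rw [if_pos hW, if_pos hW, two_mul_blockProd_div_blockProd p hp hW.1]
        refine Finset.sum_congr rfl fun T _ => ?_
        by_cases hT : T ⊆ W ∧ T ≠ W ∧ (∏ i ∈ T, p i) % 8 = 5
        · rw [if_pos hT, if_pos hT, blockProd_div_blockProd p hp hT.1]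
        · rw [if_neg hT, if_neg hT]
      · rw [if_neg hW, if_neg hW]
    · have hc : ¬ ((∏ i ∈ Sᶜ, p i) % 8 = 1 ∧ S ≠ univ) := fun h =>
        hmem ((two_mul_blockProd_mem_recursionIndex_iff p hp hodd rfl h3 S).mpr h)
      rw [if_neg (fun h => hmem (Finset.mem_filter.mp h).1), if_neg hc]
  rw [key]
  simp only [Nat.cast_sum, Nat.cast_ite, Nat.cast_mul, Nat.cast_zero]
  -- Step 2: convert each term
  have hterm : ∀ S W T : Finset (Fin k),
      (if (∏ i ∈ Sᶜ, p i) % 8 = 1 ∧ S ≠ univ then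
        (if W ⊆ S ∧ (∏ i ∈ W, p i) % 8 = 7 then
          (if T ⊆ W ∧ T ≠ W ∧ (∏ i ∈ T, p i) % 8 = 5 then
            ((L (∏ i ∈ Sᶜ, p i) : ℕ) : ZMod 2) * ((L (2 * ∏ i ∈ S \ W, p i) : ℕ) : ZMod 2) * ((L (∏ i ∈ W \ T, p i) : ℕ) : ZMod 2) *
              ((ι (∏ i ∈ T, p i) : ℕ) : ZMod 2) else 0) else 0) else 0) =
      if (∏ i ∈ T, p i) % 8 = 5 then
        (if T ⊆ W ∧ T ≠ W ∧ W ⊆ S ∧ (∏ i ∈ Sᶜ, p i) % 8 = 1 ∧ S ≠ univ ∧ (∏ i ∈ W, p i) % 8 = 7 then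
          coblockWeight p S * (monskyMatrixEven (blockPrimes p (S \ W))).det * (monskyMatrixOdd (blockPrimes p (W \ T))).det else 0) *
          FP T else 0 := by
    intro S W T
    by_cases h5 : (∏ i ∈ T, p i) % 8 = 5
    · by_cases hall : T ⊆ W ∧ T ≠ W ∧ W ⊆ S ∧ (∏ i ∈ Sᶜ, p i) % 8 = 1 ∧ S ≠ univ ∧ (∏ i ∈ W, p i) % 8 = 7
      · obtain ⟨hTW, hne, hWS, hS1, hSu, h7⟩ := hall
        have hS4 := blockProd_mod_four_of_compl_one p h3 S hS1
        have hSc : Sᶜ.Nonempty := by rw [Finset.nonempty_iff_ne_empty, Ne, Finset.compl_eq_empty_iff]; exact hSu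
        have hSW : (∏ i ∈ S \ W, p i) % 4 = 1 := sdiff_mod_four_one p hWS hS4 (by omega)
        have hWT : (W \ T).Nonempty := Finset.sdiff_nonempty.mpr (fun h => hne (Finset.Subset.antisymm hTW h))
        rw [if_pos ⟨hS1, hSu⟩, if_pos ⟨hWS, h7⟩, if_pos ⟨hTW, hne, h5⟩, if_pos h5, if_pos ⟨hTW, hne, hWS, hS1, hSu, h7⟩, hL]
        simp only []
        rw [scriptL_natAbs_blockProd_eq_det p hp hodd hinj D h11 rfl hLs Sᶜ hSc (Or.inl hS1),
          scriptL_natAbs_two_mul_blockProd_eq_det p hp hodd hinj D h11 rfl hLs (S \ W) hSW,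
          scriptL_natAbs_blockProd_eq_det p hp hodd hinj D h11 rfl hLs (W \ T) hWT (Or.inr (sdiff_mod_eight_three p hTW h7 h5)),
          hιT T h5]
        rfl
      · rw [if_pos h5, if_neg hall, zero_mul]
        by_cases hS : (∏ i ∈ Sᶜ, p i) % 8 = 1 ∧ S ≠ univ
        · rw [if_pos hS]
          by_cases hW : W ⊆ S ∧ (∏ i ∈ W, p i) % 8 = 7
          · rw [if_pos hW, if_neg (fun h => hall ⟨h.1, h.2.1, hW.1, hS.1, hS.2, hW.2⟩)]
          · rw [if_neg hW]
        · rw [if_neg hS]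
    · rw [if_neg h5]
      by_cases hS : (∏ i ∈ Sᶜ, p i) % 8 = 1 ∧ S ≠ univ
      · rw [if_pos hS]
        by_cases hW : W ⊆ S ∧ (∏ i ∈ W, p i) % 8 = 7
        · rw [if_pos hW, if_neg (fun h => h5 h.2.2)]
        · rw [if_neg hW]
      · rw [if_neg hS]
  have hswap : (∑ S : Finset (Fin k), (if (∏ i ∈ Sᶜ, p i) % 8 = 1 ∧ S ≠ univ then
      ∑ W : Finset (Fin k), (if W ⊆ S ∧ (∏ i ∈ W, p i) % 8 = 7 then
        ∑ T : Finset (Fin k), (if T ⊆ W ∧ T ≠ W ∧ (∏ i ∈ T, p i) % 8 = 5 then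
          ((L (∏ i ∈ Sᶜ, p i) : ℕ) : ZMod 2) * ((L (2 * ∏ i ∈ S \ W, p i) : ℕ) : ZMod 2) * ((L (∏ i ∈ W \ T, p i) : ℕ) : ZMod 2) *
            ((ι (∏ i ∈ T, p i) : ℕ) : ZMod 2) else 0) else 0) else 0)) =
      ∑ S : Finset (Fin k), ∑ W : Finset (Fin k), ∑ T : Finset (Fin k), (if (∏ i ∈ T, p i) % 8 = 5 then
        (if T ⊆ W ∧ T ≠ W ∧ W ⊆ S ∧ (∏ i ∈ Sᶜ, p i) % 8 = 1 ∧ S ≠ univ ∧ (∏ i ∈ W, p i) % 8 = 7 then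
          coblockWeight p S * (monskyMatrixEven (blockPrimes p (S \ W))).det * (monskyMatrixOdd (blockPrimes p (W \ T))).det else 0) *
          FP T else 0) := by
    refine Finset.sum_congr rfl fun S _ => ?_
    rw [← Finset.sum_congr rfl (fun W _ => Finset.sum_congr rfl (fun T _ => hterm S W T))]
    by_cases hS : (∏ i ∈ Sᶜ, p i) % 8 = 1 ∧ S ≠ univ
    · simp only [if_pos hS]
      refine Finset.sum_congr rfl fun W _ => ?_
      by_cases hW : W ⊆ S ∧ (∏ i ∈ W, p i) % 8 = 7
      · simp only [if_pos hW]
      · simp only [if_neg hW, Finset.sum_const_zero]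
    · simp only [if_neg hS, Finset.sum_const_zero]
  rw [hswap]
  rw [Finset.sum_congr rfl (fun S _ => Finset.sum_comm), Finset.sum_comm]
  refine Finset.sum_congr rfl fun T _ => ?_
  by_cases h5 : (∏ i ∈ T, p i) % 8 = 5
  · simp only [if_pos h5, ← Finset.sum_mul, hFP]
  · simp only [if_neg h5, Finset.sum_const_zero]

/-! ## §6 The assembled even square form -/

include hp hodd hinj in
/-- **THE EVEN SQUARE FORM (closed form of g8's even square formula, all regimes, every `g`).**  For `n = 2p₁⋯p_k` with distinct odd primes,
`∏pᵢ ≡ 3 (mod 4)`, the displayed recursion, the block clauses of `CMPointRingClassFrobeniusValuePrinted` and TYZ Thm 1.1, and ANY automorphism `g` of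
`ℍ′_n`:  `g·g·P(n) = P(n) + Ψ_n(g)·τ(1)` with
`Ψ_n(g) = Σ_{S : d_{Sᶜ} ≡ 1 (8)} coblockWeight p S·(1 + x_im + x_2 + Σ_t x_{q_t})·(Σ_t κ^S_t x_{q_t} + κ^S_∞ x_2)`
`        + Σ_{T : d_T ≡ 5 (8)} (c₂(T) + c₃(T))·(1 + x_im + Σ_t x_{q_t})·(Σ_{i∈T} ρ^T_i x_i)`,
`c₂(T) = Σ_{W ⊋ T, d_W ≡ 7} det M_even(Wᶜ)·det M_odd(W∖T)`, `c₃(T) = Σ_{S ≠ univ, d_{Sᶜ} ≡ 1} Σ_{T ⊊ W ⊆ S, d_W ≡ 7} coblockWeight p S·det M_even(S∖W)·det M_odd(W∖T)`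
(`x_im = [g(i) ≠ i]`, `x_2 = [g(i√−2) ≠ i√−2]`, `x_{q} = [g(i√−q) ≠ i√−q]`; `κ^S` = kernel sum of `N_S`, `ρ^T = blockRho p T`).  This is the Galois side of
the even Ω-identity read as the matrix form `evenSquareFormMatrix` (definitions `…EvenOmegaDefs`, up to the re-indexing `Fin S.card ↔ S`).
[cite: TianYuanZhang2017, Thm. 1.1, §3.1 (p0011 L1–L13, L53–L73), Prop. 3.2 (1)(2), Thm. 3.6 (1)(2), proof of Lemma 3.21 (p0020 L27–L63)]
[cite: HeathBrown1994SelmerCongruentII, Appendix (Monsky), typescript p. 39 L10 – p. 41 L36] [cite: Cox2013, §5.C Lemma 5.19, §7.D, §9.A] -/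
theorem galPt_mul_self_P_eq_add_evenSquareForm (hn : n = 2 * ∏ i, p i) (h3 : (∏ i, p i) % 4 = 3) (hrec : D.recursion)
    (hLs : D.scriptLSpec) (h11 : thm11_parity_of_scriptL)
    {zf : ℕ → APoint D.H} {Φf : ℕ → Finset (D.H ≃ₐ[ℚ] D.H)} {ΓHf ΓH'f : ℕ → Subgroup (D.H ≃ₐ[ℚ] D.H)}
    {σf θf : ℕ → (D.H ≃ₐ[ℚ] D.H)} {cf : D.H ≃ₐ[ℚ] D.H} (hc : D.ConjSpec cf)
    {ρ₂ : (d : ℕ) → (D.galK d →* RingClassGroup (GenusField d) 2)}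
    {ρ₄ : (d : ℕ) → (D.galK d →* RingClassGroup (GenusField d) 4)}
    (hb : ∀ d ∈ n.divisors,
      ((d % 8 = 5 ∨ d % 8 = 6) → D.CMBlockSpec d (zf d) (Φf d) (ΓHf d) (ΓH'f d) (σf d) cf) ∧
      (d % 8 = 6 → D.ThetaBlockSpec d (zf d) (ΓHf d) (ΓH'f d) (σf d) (θf d)) ∧
      (d % 8 = 7 → D.SevenBlockSpec d) ∧
      (d % 8 = 5 → D.RingClassTwoBlockSpec d (ΓHf d) (ΓH'f d) (ρ₂ d)) ∧
      (d % 8 = 6 → D.RingClassFourBlockSpec d (ΓHf d) (ΓH'f d) (ρ₄ d)) ∧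
      (d % 8 = 5 → D.FrobeniusTwoBlockSpec d (ΓH'f d)) ∧
      (d % 8 = 6 → D.FrobeniusFourBlockSpec d (ΓH'f d)) ∧
      (d % 8 = 6 → D.FrobeniusFourValueBlockSpec d (ΓH'f d) (ρ₄ d)))
    (g : D.H ≃ₐ[ℚ] D.H) :
    D.galPt (g * g) (D.P n) = D.P n +
      (ZMod.val
        ((∑ S : Finset (Fin k), if (∏ i ∈ Sᶜ, p i) % 8 = 1 then
            coblockWeight p S *
              ((1 + (if g D.im = D.im then (0 : ZMod 2) else 1) + (if g (D.im * D.sqrtNeg 2) = D.im * D.sqrtNeg 2 then (0 : ZMod 2) else 1) +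
                  ∑ t : Fin S.card,
                    (if g (D.im * D.sqrtNeg (blockPrimes p S t)) = D.im * D.sqrtNeg (blockPrimes p S t) then (0 : ZMod 2) else 1)) *
                ((∑ t : Fin S.card,
                  kerSum (Matrix.fromBlocks (legendreMatrix (blockPrimes p S) + legendreDiagonal (blockPrimes p S) (-2))
                      (Matrix.of fun j (_ : Unit) => addLegendreSym 2 (blockPrimes p S j))
                      (0 : Matrix Unit (Fin S.card) (ZMod 2)) (0 : Matrix Unit Unit (ZMod 2))) (Sum.inl t) *
                    (if g (D.im * D.sqrtNeg (blockPrimes p S t)) = D.im * D.sqrtNeg (blockPrimes p S t) then (0 : ZMod 2) else 1)) +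
                  kerSum (Matrix.fromBlocks (legendreMatrix (blockPrimes p S) + legendreDiagonal (blockPrimes p S) (-2))
                      (Matrix.of fun j (_ : Unit) => addLegendreSym 2 (blockPrimes p S j))
                      (0 : Matrix Unit (Fin S.card) (ZMod 2)) (0 : Matrix Unit Unit (ZMod 2))) (Sum.inr ()) *
                    (if g (D.im * D.sqrtNeg 2) = D.im * D.sqrtNeg 2 then (0 : ZMod 2) else 1)))
          else 0) +
        ∑ T : Finset (Fin k), if (∏ i ∈ T, p i) % 8 = 5 then
          ((∑ W : Finset (Fin k), if T ⊆ W ∧ T ≠ W ∧ (∏ i ∈ W, p i) % 8 = 7 then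
              (monskyMatrixEven (blockPrimes p Wᶜ)).det * (monskyMatrixOdd (blockPrimes p (W \ T))).det else 0) +
            ∑ S : Finset (Fin k), ∑ W : Finset (Fin k),
              if T ⊆ W ∧ T ≠ W ∧ W ⊆ S ∧ (∏ i ∈ Sᶜ, p i) % 8 = 1 ∧ S ≠ univ ∧ (∏ i ∈ W, p i) % 8 = 7 then
                coblockWeight p S * (monskyMatrixEven (blockPrimes p (S \ W))).det * (monskyMatrixOdd (blockPrimes p (W \ T))).det
              else 0) *
            ((1 + (if g D.im = D.im then (0 : ZMod 2) else 1) +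
                ∑ t : Fin T.card, (if g (D.im * D.sqrtNeg (blockPrimes p T t)) = D.im * D.sqrtNeg (blockPrimes p T t) then (0 : ZMod 2) else 1)) *
              ∑ i ∈ T, blockRho p T i * (if g (D.im * D.sqrtNeg (p i)) = D.im * D.sqrtNeg (p i) then (0 : ZMod 2) else 1))
        else 0)) • tauOne := by
  have hp2 : ∀ i, p i ≠ 2 := ne_two_of_odd p hodd
  have hsq : Squarefree n := by
    rw [hn, ← prod_cons_two_eq p]
    exact squarefree_prod_of_injective _ (prime_cons_two p hp) (injective_cons_two p hodd hinj)
  have hmodd : Odd (∏ i, p i) := odd_prod p hp hp2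
  have h6 : n % 8 = 6 := by rcases hmodd with ⟨r, hr⟩; omega
  rw [galPt_mul_self_P_eq_add_even D hsq h6 hrec zf Φf ΓHf ΓH'f σf cf hc (fun d hd => ⟨(hb d hd).1, (hb d hd).2.2.1⟩) g,
    nsmul_tauOne_eq_mod_two]
  congr 2
  rw [← ZMod.val_natCast]
  congr 1
  rw [Nat.cast_add, Nat.cast_add, levelOne_eq_sum_blocks p hp hodd hinj D hn h3 hLs h11 hb g,
    levelTwo_eq_sum_blocks p hp hodd hinj D hn h3 hLs h11 hb g, levelThree_eq_sum_blocks p hp hodd hinj D hn h3 hLs h11 hb g,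
    add_assoc, ← Finset.sum_add_distrib]
  congr 1
  refine Finset.sum_congr rfl fun T _ => ?_
  by_cases h5 : (∏ i ∈ T, p i) % 8 = 5
  · simp only [if_pos h5, add_mul]
  · simp only [if_neg h5, add_zero]

end Summit.BirchSwinnertonDyer.PrintCf2.MoverAssembly

end
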